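/-
Copyright (c) 2026 the pub-hodgecm-mathlib formalisation cell (harness21).  Prover seat hodgecm-mathlib-K2Liu-p23 (g2), Track B «K2-LIT»,
#184♮ = hLiu418 = `stmt-HodgeConjecture-24832`; #42F′ FACE-G organ F4 (G-gen), road (E) (RULINGS M-158r/s/u), THE BRIDGE «(A) invariant-theory ring →
(F) Fock ring» (F4 lead K2Liu-p27 (g2) 2026-09-04T23:13:35Z ∕ 23:15:26Z (B); LEAD F0P6-plan (g14) BATCH #128).
KERNEL: theorems only.
-/
import Literature.Analysis.SegalBargmann.FockDualPairCompact      -- ★ `DPIdx`, `DPK`, `dualPairι`, `coe_dualPairι`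
import Literature.Analysis.SegalBargmann.FockUnitaryAction        -- ★ `linSubst`, `linSubst_X`, `linSubst_C`
import Mathlib.RingTheory.Adjoin.Basic
import HarnessLib

/-!
# Crux `HLiu418`, FACE-G organ F4, road (E): THE BRIDGE (A) invariant-theory rings → (F) Fock ring, part 1 —
# the `K_H = U(R) × U(S)`-substitution on the block variables, and the coefficient machinery

Cell `hodgecm-mathlib`, crux item hLiu418 = `stmt-HodgeConjecture-24832`, route of record `HCCMUnconditional`; squad K2 ∕ K2Liu, road `K2_Liu`,
socket #42F′, FACE-G organ F4 (G-gen) under RULING M-158r «(E) COMPACT SEE-SAW + FFT + PBW INDUCTION + `K_H`-AVERAGING» (K2E5-r02 (g6)); F4 lead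
K2Liu-p27 (g2), desks K2Liu-p10 (g6) ∕ K2E5-r02 (g6).  THEOREMS ONLY (no `def`, no `instance`, no `notation`, no named-fact hypothesis, no `sorry`);
lane `--supports stmt-HodgeConjecture-24832 --as helper` (count-neutral helper).

THE TWO RINGS (F4 lead 23:13:35Z).  (F) the FOCK ring `𝒫 = MvPolynomial (DPIdx P Q R S) ℂ` of ★ `FockDualPairCompact`
(`DPIdx P Q R S = ((P × R) ⊕ (Q × S)) ⊕ ((P × S) ⊕ (Q × R))`; at a real place of signature `(p,q)`: `P = Q = Fin 2`, `|R| = p`, `|S| = q`), on which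
the compact dual pair acts through ★ `dualPairι` and ★ `linSubst` (★ `κOp_binvPi`: `κOp e k (B⁻¹F) = B⁻¹(vacScalar e k • linSubst (star ↑(dualPairι k)) F)`);
(A) the INVARIANT-THEORY rings of the two blocks, `A_R = MvPolynomial ((P × R) ⊕ (Q × R)) ℂ` (the `R`-variables `x^R_{(p,r)} = X (inl (inl (p,r)))`,
`y^R_{(q,r)} = X (inr (inr (q,r)))` of `𝒫`) and `A_S = MvPolynomial ((Q × S) ⊕ (P × S)) ℂ` (`x^S_{(q,s)} = X (inl (inr (q,s)))`, `y^S_{(p,s)} = X (inr (inl (p,s)))`),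
embedded by the renamings `ιR = rename (Sum.map inl inr)`, `ιS = rename (Sum.map inr inl)` (written inline).  READ OFF ★ `coe_dualPairι` BY VALUE (§1):
the `K_H`-element `(1,(c,d))`, `c ∈ U(R)`, `d ∈ U(S)`, acts on the `R`-variables by `x^R ↦ x^R·c`, `y^R ↦ y^R·c̄` and on the `S`-variables by
`x^S ↦ x^S·d`, `y^S ↦ y^S·d̄` — i.e. by the substitution `σ_c` of (E-a0) `K2LiuUnitaryPolySubstDefs.substFun (toUnits c)` (`x_{(i,a)} ↦ Σ_b x_{(i,b)} c_{ba}`,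
`y_{(j,a)} ↦ Σ_b y_{(j,b)} (c̄)_{ab}`), here spelled in ABSTRACT-index currency (`R`, `S` any finite types; labels `P`, `Q`).

WHAT IS HERE (all proved):
* § 1 `linSubst_dualPairι_X_xR ∕ _yR ∕ _xS ∕ _yS` (the four variable rows of `star ↑(dualPairι (1,(c,d)))`), **`linSubst_dualPairι_rename_R`**,
  **`linSubst_dualPairι_rename_S`** (`linSubst (star ↑(dualPairι (1,(c,d)))) ∘ ιR = ιR ∘ aeval σ_c`, `… ∘ ιS = ιS ∘ aeval σ_d`), `rename_contractionR ∕ S`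
  (`ιR (Σ_r x^R_{(p,r)} y^R_{(q,r)}) = C^R_{(p,q)}`, `ιS (Σ_s x^S_{(q,s)} y^S_{(p,s)}) = C^S_{(p,q)}` in ★ (E-b)'s inline spelling).
* § 2 COEFFICIENT MACHINERY (no `TensorProduct`): `Θ = aeval θ : 𝒫 →ₐ[ℂ] MvPolynomial (S-vars) A_R` (`x^R, y^R ↦` constants, `x^S, y^S ↦` variables),
  `Θ ∘ ιR = C`, `Θ ∘ ιS = map (algebraMap ℂ A_R)`, the left inverse `eval₂Hom ιR (X ∘ jS) ∘ Θ = id`, the expansion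
  `F = Σ_ν ιR (coeff ν (Θ F)) · ιS (X^ν)`, and `coeff ν (Θ (ιR h · ιS g)) = coeff ν g • h`.
* the sequel `K2LiuFockInvariantsOfBlocks` uses § 1–§ 2 to prove «tensor invariants are products of invariants» and the letter **(FFT)** of ★ (E-f)
  `K2LiuLocalThetaCyclicUniform` at the Fock instance from the two BLOCK first fundamental theorems [cite: Weyl1939, Thm. 2.6.A]
  [cite: GoodmanWallachGTM255, Thm. 5.2.1].
References: [Howe1989Remarks] §2–§3 (the Fock-model see-saw); [KashiwaraVergne1978] §II; [Weyl1939] Thm. 2.6.A; [GoodmanWallachGTM255] Thm. 5.2.1.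
HONEST LABEL.  Count-neutral helper; it retires nothing by itself: `HC_CM` is proved only modulo the 7 printed citations (2 remaining named inputs:
hLiu418 = `stmt-HodgeConjecture-24832`, h413 = `stmt-HodgeConjecture-24833`) until rung 0 closes.

## References
* [Howe1989Remarks] R. Howe, *Remarks on classical invariant theory*, Trans. AMS 313 (1989), §2–§3.
* [KashiwaraVergne1978] M. Kashiwara, M. Vergne, *On the Segal–Shale–Weil representations and harmonic polynomials*, Invent. Math. 44 (1978), §II.
* [Weyl1939] H. Weyl, *The Classical Groups*, Princeton (1939), Ch. II §6, Thm. 2.6.A.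
* [GoodmanWallachGTM255] R. Goodman, N. R. Wallach, *Symmetry, Representations, and Invariants*, GTM 255 (2009), Thm. 5.2.1.
-/

set_option autoImplicit false
set_option linter.dupNamespace false -- the mandated namespace repeats `HodgeConjecture.HodgeConjecture`

open scoped BigOperators Kronecker
open MvPolynomial Matrix
open Literature.Analysis.SegalBargmann

namespace Summit.HodgeConjecture.HodgeConjecture.Cruxes.HLiu418.K2LiuFockPolySubstBridge

variable {P Q R S : Type*} [Fintype P] [DecidableEq P] [Fintype Q] [DecidableEq Q] [Fintype R] [DecidableEq R]
  [Fintype S] [DecidableEq S]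

/-! ## § 1 The `K_H`-substitution on the four kinds of variables, by value off ★ `coe_dualPairι` -/

/-- entries of `star ↑(dualPairι (1,(c,d)))`, row `x^R_{(p,r)}`: only the `x^R`-block is non-zero, with entry `δ_{pp′} c_{r′r}`. [folklore] -/
theorem star_dualPairι_apply_xR (c : Matrix.unitaryGroup R ℂ) (d : Matrix.unitaryGroup S ℂ) (pr : P × R) (w : DPIdx P Q R S) :
    (star ((dualPairι ((1, (c, d)) : DPK P Q R S) : Matrix.unitaryGroup (DPIdx P Q R S) ℂ) : Matrix (DPIdx P Q R S) (DPIdx P Q R S) ℂ))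
        (Sum.inl (Sum.inl pr)) w =
      Sum.elim (Sum.elim (fun pr' : P × R => if pr'.1 = pr.1 then (c : Matrix R R ℂ) pr'.2 pr.2 else 0) (fun _ => 0))
        (Sum.elim (fun _ => 0) (fun _ => 0)) w := by
  rw [Matrix.star_apply, coe_dualPairι]
  rcases w with (pr' | qs') | (ps' | qr')
  · simp only [Matrix.fromBlocks_apply₁₁, Matrix.map_apply, Matrix.kroneckerMap_apply, Prod.fst_one, Prod.snd_one,
      OneMemClass.coe_one, Matrix.one_apply, Sum.elim_inl]
    split_ifs <;> simp
  · simp only [Matrix.fromBlocks_apply₁₁, Matrix.fromBlocks_apply₂₁, Matrix.zero_apply, star_zero, Sum.elim_inl, Sum.elim_inr]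
  · simp only [Matrix.fromBlocks_apply₂₁, Matrix.zero_apply, star_zero, Sum.elim_inr, Sum.elim_inl]
  · simp only [Matrix.fromBlocks_apply₂₁, Matrix.zero_apply, star_zero, Sum.elim_inr]

/-- entries of `star ↑(dualPairι (1,(c,d)))`, row `y^R_{(q,r)}`: only the `y^R`-block is non-zero, with entry `δ_{qq′} (c̄)_{r′r}`. [folklore] -/
theorem star_dualPairι_apply_yR (c : Matrix.unitaryGroup R ℂ) (d : Matrix.unitaryGroup S ℂ) (qr : Q × R) (w : DPIdx P Q R S) :
    (star ((dualPairι ((1, (c, d)) : DPK P Q R S) : Matrix.unitaryGroup (DPIdx P Q R S) ℂ) : Matrix (DPIdx P Q R S) (DPIdx P Q R S) ℂ))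
        (Sum.inr (Sum.inr qr)) w =
      Sum.elim (Sum.elim (fun _ => 0) (fun _ => 0))
        (Sum.elim (fun _ => 0) (fun qr' : Q × R => if qr'.1 = qr.1 then (star (c : Matrix R R ℂ)) qr.2 qr'.2 else 0)) w := by
  rw [Matrix.star_apply, coe_dualPairι]
  rcases w with (pr' | qs') | (ps' | qr')
  · simp only [Matrix.fromBlocks_apply₁₂, Matrix.zero_apply, star_zero, Sum.elim_inl]
  · simp only [Matrix.fromBlocks_apply₁₂, Matrix.zero_apply, star_zero, Sum.elim_inl, Sum.elim_inr]
  · simp only [Matrix.fromBlocks_apply₂₂, Matrix.fromBlocks_apply₁₂, Matrix.zero_apply, star_zero, Sum.elim_inr, Sum.elim_inl]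
  · simp only [Matrix.fromBlocks_apply₂₂, Matrix.kroneckerMap_apply, Prod.fst_one, Prod.snd_one, OneMemClass.coe_one, Matrix.one_apply,
      Sum.elim_inr, Matrix.star_apply]
    split_ifs <;> simp

/-- entries of `star ↑(dualPairι (1,(c,d)))`, row `x^S_{(q,s)}`: only the `x^S`-block is non-zero, with entry `δ_{qq′} d_{s′s}`. [folklore] -/
theorem star_dualPairι_apply_xS (c : Matrix.unitaryGroup R ℂ) (d : Matrix.unitaryGroup S ℂ) (qs : Q × S) (w : DPIdx P Q R S) :
    (star ((dualPairι ((1, (c, d)) : DPK P Q R S) : Matrix.unitaryGroup (DPIdx P Q R S) ℂ) : Matrix (DPIdx P Q R S) (DPIdx P Q R S) ℂ))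
        (Sum.inl (Sum.inr qs)) w =
      Sum.elim (Sum.elim (fun _ => 0) (fun qs' : Q × S => if qs'.1 = qs.1 then (d : Matrix S S ℂ) qs'.2 qs.2 else 0))
        (Sum.elim (fun _ => 0) (fun _ => 0)) w := by
  rw [Matrix.star_apply, coe_dualPairι]
  rcases w with (pr' | qs') | (ps' | qr')
  · simp only [Matrix.fromBlocks_apply₁₁, Matrix.fromBlocks_apply₁₂, Matrix.zero_apply, star_zero, Sum.elim_inl]
  · simp only [Matrix.fromBlocks_apply₁₁, Matrix.fromBlocks_apply₂₂, Matrix.map_apply, Matrix.kroneckerMap_apply, Prod.fst_one, Prod.snd_one,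
      OneMemClass.coe_one, Matrix.one_apply, Sum.elim_inl, Sum.elim_inr]
    split_ifs <;> simp
  · simp only [Matrix.fromBlocks_apply₂₁, Matrix.zero_apply, star_zero, Sum.elim_inr, Sum.elim_inl]
  · simp only [Matrix.fromBlocks_apply₂₁, Matrix.zero_apply, star_zero, Sum.elim_inr]

/-- entries of `star ↑(dualPairι (1,(c,d)))`, row `y^S_{(p,s)}`: only the `y^S`-block is non-zero, with entry `δ_{pp′} (d̄)_{s′s}`. [folklore] -/
theorem star_dualPairι_apply_yS (c : Matrix.unitaryGroup R ℂ) (d : Matrix.unitaryGroup S ℂ) (ps : P × S) (w : DPIdx P Q R S) :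
    (star ((dualPairι ((1, (c, d)) : DPK P Q R S) : Matrix.unitaryGroup (DPIdx P Q R S) ℂ) : Matrix (DPIdx P Q R S) (DPIdx P Q R S) ℂ))
        (Sum.inr (Sum.inl ps)) w =
      Sum.elim (Sum.elim (fun _ => 0) (fun _ => 0))
        (Sum.elim (fun ps' : P × S => if ps'.1 = ps.1 then (star (d : Matrix S S ℂ)) ps.2 ps'.2 else 0) (fun _ => 0)) w := by
  rw [Matrix.star_apply, coe_dualPairι]
  rcases w with (pr' | qs') | (ps' | qr')
  · simp only [Matrix.fromBlocks_apply₁₂, Matrix.zero_apply, star_zero, Sum.elim_inl]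
  · simp only [Matrix.fromBlocks_apply₁₂, Matrix.zero_apply, star_zero, Sum.elim_inl, Sum.elim_inr]
  · simp only [Matrix.fromBlocks_apply₂₂, Matrix.fromBlocks_apply₁₁, Matrix.kroneckerMap_apply, Prod.fst_one, Prod.snd_one, OneMemClass.coe_one,
      Matrix.one_apply, Sum.elim_inr, Sum.elim_inl, Matrix.star_apply]
    split_ifs <;> simp
  · simp only [Matrix.fromBlocks_apply₂₂, Matrix.fromBlocks_apply₂₁, Matrix.zero_apply, star_zero, Sum.elim_inr]

/-- **the `K_H`-substitution on `x^R_{(p,r)}`**: `x^R_{(p,r)} ↦ Σ_b c_{br} · x^R_{(p,b)}` (`x^R ↦ x^R·c`). [cite: KashiwaraVergne1978, §II] -/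
theorem linSubst_dualPairι_X_xR (c : Matrix.unitaryGroup R ℂ) (d : Matrix.unitaryGroup S ℂ) (pr : P × R) :
    linSubst (star ((dualPairι ((1, (c, d)) : DPK P Q R S) : Matrix.unitaryGroup (DPIdx P Q R S) ℂ) :
        Matrix (DPIdx P Q R S) (DPIdx P Q R S) ℂ)) (X (Sum.inl (Sum.inl pr)) : MvPolynomial (DPIdx P Q R S) ℂ) =
      ∑ b : R, C ((c : Matrix R R ℂ) b pr.2) * X (Sum.inl (Sum.inl (pr.1, b))) := by
  rw [linSubst_X]
  simp only [star_dualPairι_apply_xR, Fintype.sum_sum_type, Sum.elim_inl, Sum.elim_inr, map_zero, zero_mul, Finset.sum_const_zero,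
    add_zero]
  rw [Fintype.sum_prod_type]
  simp only [apply_ite C, map_zero, ite_mul, zero_mul, Finset.sum_ite_irrel, Finset.sum_const_zero, Finset.sum_ite_eq', Finset.mem_univ,
    if_true]

/-- **the `K_H`-substitution on `y^R_{(q,r)}`**: `y^R_{(q,r)} ↦ Σ_b (c̄)ᵀ… = Σ_b (star c)_{rb} · y^R_{(q,b)}` (`y^R ↦ y^R·c̄ = y^R·(c⁻¹)ᵀ`).
[cite: KashiwaraVergne1978, §II] -/
theorem linSubst_dualPairι_X_yR (c : Matrix.unitaryGroup R ℂ) (d : Matrix.unitaryGroup S ℂ) (qr : Q × R) :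
    linSubst (star ((dualPairι ((1, (c, d)) : DPK P Q R S) : Matrix.unitaryGroup (DPIdx P Q R S) ℂ) :
        Matrix (DPIdx P Q R S) (DPIdx P Q R S) ℂ)) (X (Sum.inr (Sum.inr qr)) : MvPolynomial (DPIdx P Q R S) ℂ) =
      ∑ b : R, C ((star (c : Matrix R R ℂ)) qr.2 b) * X (Sum.inr (Sum.inr (qr.1, b))) := by
  rw [linSubst_X]
  simp only [star_dualPairι_apply_yR, Fintype.sum_sum_type, Sum.elim_inl, Sum.elim_inr, map_zero, zero_mul, Finset.sum_const_zero,
    zero_add]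
  rw [Fintype.sum_prod_type]
  simp only [apply_ite C, map_zero, ite_mul, zero_mul, Finset.sum_ite_irrel, Finset.sum_const_zero, Finset.sum_ite_eq', Finset.mem_univ,
    if_true]

/-- **the `K_H`-substitution on `x^S_{(q,s)}`**: `x^S_{(q,s)} ↦ Σ_b d_{bs} · x^S_{(q,b)}` (`x^S ↦ x^S·d`). [cite: KashiwaraVergne1978, §II] -/
theorem linSubst_dualPairι_X_xS (c : Matrix.unitaryGroup R ℂ) (d : Matrix.unitaryGroup S ℂ) (qs : Q × S) :
    linSubst (star ((dualPairι ((1, (c, d)) : DPK P Q R S) : Matrix.unitaryGroup (DPIdx P Q R S) ℂ) :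
        Matrix (DPIdx P Q R S) (DPIdx P Q R S) ℂ)) (X (Sum.inl (Sum.inr qs)) : MvPolynomial (DPIdx P Q R S) ℂ) =
      ∑ b : S, C ((d : Matrix S S ℂ) b qs.2) * X (Sum.inl (Sum.inr (qs.1, b))) := by
  rw [linSubst_X]
  simp only [star_dualPairι_apply_xS, Fintype.sum_sum_type, Sum.elim_inl, Sum.elim_inr, map_zero, zero_mul, Finset.sum_const_zero,
    add_zero, zero_add]
  rw [Fintype.sum_prod_type]
  simp only [apply_ite C, map_zero, ite_mul, zero_mul, Finset.sum_ite_irrel, Finset.sum_const_zero, Finset.sum_ite_eq', Finset.mem_univ,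
    if_true]

/-- **the `K_H`-substitution on `y^S_{(p,s)}`**: `y^S_{(p,s)} ↦ Σ_b (star d)_{sb} · y^S_{(p,b)}` (`y^S ↦ y^S·d̄`). [cite: KashiwaraVergne1978, §II] -/
theorem linSubst_dualPairι_X_yS (c : Matrix.unitaryGroup R ℂ) (d : Matrix.unitaryGroup S ℂ) (ps : P × S) :
    linSubst (star ((dualPairι ((1, (c, d)) : DPK P Q R S) : Matrix.unitaryGroup (DPIdx P Q R S) ℂ) :
        Matrix (DPIdx P Q R S) (DPIdx P Q R S) ℂ)) (X (Sum.inr (Sum.inl ps)) : MvPolynomial (DPIdx P Q R S) ℂ) =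
      ∑ b : S, C ((star (d : Matrix S S ℂ)) ps.2 b) * X (Sum.inr (Sum.inl (ps.1, b))) := by
  rw [linSubst_X]
  simp only [star_dualPairι_apply_yS, Fintype.sum_sum_type, Sum.elim_inl, Sum.elim_inr, map_zero, zero_mul, Finset.sum_const_zero,
    add_zero, zero_add]
  rw [Fintype.sum_prod_type]
  simp only [apply_ite C, map_zero, ite_mul, zero_mul, Finset.sum_ite_irrel, Finset.sum_const_zero, Finset.sum_ite_eq', Finset.mem_univ,
    if_true]

/-- **THE `K_H`-SUBSTITUTION ON THE `R`-BLOCK IS (E-a0)'s `σ_c`**: `linSubst (star ↑(dualPairι (1,(c,d)))) ∘ ιR = ιR ∘ aeval σ_c` with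
`σ_c (x_{(p,r)}) = Σ_b x_{(p,b)} · C c_{br}`, `σ_c (y_{(q,r)}) = Σ_b y_{(q,b)} · C (star c)_{rb}` — the substitution `x ↦ x·c`, `y ↦ y·c̄` of
`K2LiuUnitaryPolySubstDefs.substFun (toUnits c)` in abstract-index currency. [cite: KashiwaraVergne1978, §II] [cite: Howe1989Remarks, §2] -/
theorem linSubst_dualPairι_rename_R (c : Matrix.unitaryGroup R ℂ) (d : Matrix.unitaryGroup S ℂ) (f : MvPolynomial ((P × R) ⊕ (Q × R)) ℂ) :
    linSubst (star ((dualPairι ((1, (c, d)) : DPK P Q R S) : Matrix.unitaryGroup (DPIdx P Q R S) ℂ) :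
        Matrix (DPIdx P Q R S) (DPIdx P Q R S) ℂ))
      (rename (Sum.map Sum.inl Sum.inr : (P × R) ⊕ (Q × R) → DPIdx P Q R S) f) =
      rename (Sum.map Sum.inl Sum.inr : (P × R) ⊕ (Q × R) → DPIdx P Q R S)
        (aeval (Sum.elim (fun pr : P × R => ∑ b : R, X (Sum.inl (pr.1, b)) * C ((c : Matrix R R ℂ) b pr.2))
          (fun qr : Q × R => ∑ b : R, X (Sum.inr (qr.1, b)) * C ((star (c : Matrix R R ℂ)) qr.2 b)) :
            (P × R) ⊕ (Q × R) → MvPolynomial ((P × R) ⊕ (Q × R)) ℂ) f) := by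
  rw [← AlgHom.comp_apply, ← AlgHom.comp_apply]
  congr 1
  refine MvPolynomial.algHom_ext fun v => ?_
  rcases v with ⟨p, r⟩ | ⟨q, r⟩
  · simp only [AlgHom.comp_apply, rename_X, Sum.map_inl, aeval_X, Sum.elim_inl, map_sum, map_mul, algHom_C, algebraMap_eq]
    rw [linSubst_dualPairι_X_xR]
    exact Finset.sum_congr rfl fun b _ => mul_comm _ _
  · simp only [AlgHom.comp_apply, rename_X, Sum.map_inr, aeval_X, Sum.elim_inr, map_sum, map_mul, algHom_C, algebraMap_eq]
    rw [linSubst_dualPairι_X_yR]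
    exact Finset.sum_congr rfl fun b _ => mul_comm _ _

/-- **THE `K_H`-SUBSTITUTION ON THE `S`-BLOCK IS (E-a0)'s `σ_d`**: `linSubst (star ↑(dualPairι (1,(c,d)))) ∘ ιS = ιS ∘ aeval σ_d` with
`σ_d (x_{(q,s)}) = Σ_b x_{(q,b)} · C d_{bs}`, `σ_d (y_{(p,s)}) = Σ_b y_{(p,b)} · C (star d)_{sb}`. [cite: KashiwaraVergne1978, §II] [cite: Howe1989Remarks, §2] -/
theorem linSubst_dualPairι_rename_S (c : Matrix.unitaryGroup R ℂ) (d : Matrix.unitaryGroup S ℂ) (g : MvPolynomial ((Q × S) ⊕ (P × S)) ℂ) :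
    linSubst (star ((dualPairι ((1, (c, d)) : DPK P Q R S) : Matrix.unitaryGroup (DPIdx P Q R S) ℂ) :
        Matrix (DPIdx P Q R S) (DPIdx P Q R S) ℂ))
      (rename (Sum.map Sum.inr Sum.inl : (Q × S) ⊕ (P × S) → DPIdx P Q R S) g) =
      rename (Sum.map Sum.inr Sum.inl : (Q × S) ⊕ (P × S) → DPIdx P Q R S)
        (aeval (Sum.elim (fun qs : Q × S => ∑ b : S, X (Sum.inl (qs.1, b)) * C ((d : Matrix S S ℂ) b qs.2))
          (fun ps : P × S => ∑ b : S, X (Sum.inr (ps.1, b)) * C ((star (d : Matrix S S ℂ)) ps.2 b)) :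
            (Q × S) ⊕ (P × S) → MvPolynomial ((Q × S) ⊕ (P × S)) ℂ) g) := by
  rw [← AlgHom.comp_apply, ← AlgHom.comp_apply]
  congr 1
  refine MvPolynomial.algHom_ext fun v => ?_
  rcases v with ⟨q, s⟩ | ⟨p, s⟩
  · simp only [AlgHom.comp_apply, rename_X, Sum.map_inl, aeval_X, Sum.elim_inl, map_sum, map_mul, algHom_C, algebraMap_eq]
    rw [linSubst_dualPairι_X_xS]
    exact Finset.sum_congr rfl fun b _ => mul_comm _ _
  · simp only [AlgHom.comp_apply, rename_X, Sum.map_inr, aeval_X, Sum.elim_inr, map_sum, map_mul, algHom_C, algebraMap_eq]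
    rw [linSubst_dualPairι_X_yS]
    exact Finset.sum_congr rfl fun b _ => mul_comm _ _

omit [Fintype P] [DecidableEq P] [Fintype Q] [DecidableEq Q] [DecidableEq R] [Fintype S] [DecidableEq S] in
/-- **`ιR` of the `R`-contraction is ★ (E-b)'s `C^R`**: `ιR (Σ_r x^R_{(p,r)} y^R_{(q,r)}) = Σ_r X (inl (inl (p,r))) * X (inr (inr (q,r)))`.
[cite: Howe1989Remarks, §3] -/
theorem rename_contractionR (i : P × Q) :
    rename (Sum.map Sum.inl Sum.inr : (P × R) ⊕ (Q × R) → DPIdx P Q R S)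
        (∑ r : R, X (Sum.inl (i.1, r)) * X (Sum.inr (i.2, r)) : MvPolynomial ((P × R) ⊕ (Q × R)) ℂ) =
      ∑ r : R, X (Sum.inl (Sum.inl (i.1, r))) * X (Sum.inr (Sum.inr (i.2, r))) := by
  simp only [map_sum, map_mul, rename_X, Sum.map_inl, Sum.map_inr]

omit [Fintype P] [DecidableEq P] [Fintype Q] [DecidableEq Q] [Fintype R] [DecidableEq R] [DecidableEq S] in
/-- **`ιS` of the `S`-contraction is ★ (E-b)'s `C^S`**: `ιS (Σ_s x^S_{(q,s)} y^S_{(p,s)}) = Σ_s X (inr (inl (p,s))) * X (inl (inr (q,s)))`.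
[cite: Howe1989Remarks, §3] -/
theorem rename_contractionS (i : P × Q) :
    rename (Sum.map Sum.inr Sum.inl : (Q × S) ⊕ (P × S) → DPIdx P Q R S)
        (∑ s : S, X (Sum.inl (i.2, s)) * X (Sum.inr (i.1, s)) : MvPolynomial ((Q × S) ⊕ (P × S)) ℂ) =
      ∑ s : S, X (Sum.inr (Sum.inl (i.1, s))) * X (Sum.inl (Sum.inr (i.2, s))) := by
  simp only [map_sum, map_mul, rename_X, Sum.map_inl, Sum.map_inr]
  exact Finset.sum_congr rfl fun s _ => mul_comm _ _


/-! ## § 2 Coefficient machinery: `𝒫` read as polynomials in the `S`-variables with coefficients in `A_R` (no `TensorProduct`) -/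

omit [Fintype P] [DecidableEq P] [Fintype Q] [DecidableEq Q] [Fintype R] [DecidableEq R] [Fintype S] [DecidableEq S] in
/-- **`Θ ∘ ιR = C`**: the reading `Θ` (`x^R, y^R ↦` constant variables, `x^S, y^S ↦` variables) sends an `R`-block polynomial to the constant it is.
[folklore] -/
theorem theta_rename_R (h : MvPolynomial ((P × R) ⊕ (Q × R)) ℂ) :
    aeval (Sum.elim
          (Sum.elim (fun pr : P × R => C (X (Sum.inl pr) : MvPolynomial ((P × R) ⊕ (Q × R)) ℂ)) (fun qs : Q × S => X (Sum.inl qs)))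
          (Sum.elim (fun ps : P × S => X (Sum.inr ps)) (fun qr : Q × R => C (X (Sum.inr qr) : MvPolynomial ((P × R) ⊕ (Q × R)) ℂ))) :
          DPIdx P Q R S → MvPolynomial ((Q × S) ⊕ (P × S)) (MvPolynomial ((P × R) ⊕ (Q × R)) ℂ))
        (rename (Sum.map Sum.inl Sum.inr : (P × R) ⊕ (Q × R) → DPIdx P Q R S) h) = C h := by
  have key : ((aeval (Sum.elim
          (Sum.elim (fun pr : P × R => C (X (Sum.inl pr) : MvPolynomial ((P × R) ⊕ (Q × R)) ℂ)) (fun qs : Q × S => X (Sum.inl qs)))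
          (Sum.elim (fun ps : P × S => X (Sum.inr ps)) (fun qr : Q × R => C (X (Sum.inr qr) : MvPolynomial ((P × R) ⊕ (Q × R)) ℂ))) :
          DPIdx P Q R S → MvPolynomial ((Q × S) ⊕ (P × S)) (MvPolynomial ((P × R) ⊕ (Q × R)) ℂ))).comp
      (rename (Sum.map Sum.inl Sum.inr : (P × R) ⊕ (Q × R) → DPIdx P Q R S)) : MvPolynomial ((P × R) ⊕ (Q × R)) ℂ →ₐ[ℂ] _) =
      IsScalarTower.toAlgHom ℂ (MvPolynomial ((P × R) ⊕ (Q × R)) ℂ) _ := by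
    refine MvPolynomial.algHom_ext fun v => ?_
    rcases v with pr | qr
    · simp only [AlgHom.comp_apply, rename_X, Sum.map_inl, aeval_X, Sum.elim_inl, IsScalarTower.toAlgHom_apply, algebraMap_eq]
    · simp only [AlgHom.comp_apply, rename_X, Sum.map_inr, aeval_X, Sum.elim_inr, IsScalarTower.toAlgHom_apply, algebraMap_eq]
  have := congrArg (fun φ : MvPolynomial ((P × R) ⊕ (Q × R)) ℂ →ₐ[ℂ] _ => φ h) key
  simpa only [AlgHom.comp_apply, IsScalarTower.toAlgHom_apply, algebraMap_eq] using this

omit [Fintype P] [DecidableEq P] [Fintype Q] [DecidableEq Q] [Fintype R] [DecidableEq R] [Fintype S] [DecidableEq S] in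
/-- **`Θ ∘ ιS = map (algebraMap ℂ A_R)`**: the reading `Θ` sends an `S`-block polynomial to itself with scalars extended to `A_R`. [folklore] -/
theorem theta_rename_S (g : MvPolynomial ((Q × S) ⊕ (P × S)) ℂ) :
    aeval (Sum.elim
          (Sum.elim (fun pr : P × R => C (X (Sum.inl pr) : MvPolynomial ((P × R) ⊕ (Q × R)) ℂ)) (fun qs : Q × S => X (Sum.inl qs)))
          (Sum.elim (fun ps : P × S => X (Sum.inr ps)) (fun qr : Q × R => C (X (Sum.inr qr) : MvPolynomial ((P × R) ⊕ (Q × R)) ℂ))) :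
          DPIdx P Q R S → MvPolynomial ((Q × S) ⊕ (P × S)) (MvPolynomial ((P × R) ⊕ (Q × R)) ℂ))
        (rename (Sum.map Sum.inr Sum.inl : (Q × S) ⊕ (P × S) → DPIdx P Q R S) g) =
      map (algebraMap ℂ (MvPolynomial ((P × R) ⊕ (Q × R)) ℂ)) g := by
  have key : ((aeval (Sum.elim
          (Sum.elim (fun pr : P × R => C (X (Sum.inl pr) : MvPolynomial ((P × R) ⊕ (Q × R)) ℂ)) (fun qs : Q × S => X (Sum.inl qs)))
          (Sum.elim (fun ps : P × S => X (Sum.inr ps)) (fun qr : Q × R => C (X (Sum.inr qr) : MvPolynomial ((P × R) ⊕ (Q × R)) ℂ))) :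
          DPIdx P Q R S → MvPolynomial ((Q × S) ⊕ (P × S)) (MvPolynomial ((P × R) ⊕ (Q × R)) ℂ))).comp
      (rename (Sum.map Sum.inr Sum.inl : (Q × S) ⊕ (P × S) → DPIdx P Q R S)) : MvPolynomial ((Q × S) ⊕ (P × S)) ℂ →ₐ[ℂ] _) =
      mapAlgHom (Algebra.ofId ℂ (MvPolynomial ((P × R) ⊕ (Q × R)) ℂ)) := by
    refine MvPolynomial.algHom_ext fun w => ?_
    rcases w with qs | ps
    · simp only [AlgHom.comp_apply, rename_X, Sum.map_inl, aeval_X, Sum.elim_inl, Sum.elim_inr, mapAlgHom_apply, map_X]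
    · simp only [AlgHom.comp_apply, rename_X, Sum.map_inr, aeval_X, Sum.elim_inr, Sum.elim_inl, mapAlgHom_apply, map_X]
  have := congrArg (fun φ : MvPolynomial ((Q × S) ⊕ (P × S)) ℂ →ₐ[ℂ] _ => φ g) key
  simpa only [AlgHom.comp_apply, mapAlgHom_apply, Algebra.toRingHom_ofId] using this

omit [Fintype P] [DecidableEq P] [Fintype Q] [DecidableEq Q] [Fintype R] [DecidableEq R] [Fintype S] [DecidableEq S] in
/-- **the reading `Θ` has the left inverse `eval₂Hom ιR (X ∘ jS)`** (substitute the `S`-variables back and embed the `A_R`-coefficients). [folklore] -/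
theorem eval₂Hom_theta (F : MvPolynomial (DPIdx P Q R S) ℂ) :
    eval₂Hom ((rename (Sum.map Sum.inl Sum.inr : (P × R) ⊕ (Q × R) → DPIdx P Q R S) :
        MvPolynomial ((P × R) ⊕ (Q × R)) ℂ →ₐ[ℂ] MvPolynomial (DPIdx P Q R S) ℂ) : MvPolynomial ((P × R) ⊕ (Q × R)) ℂ →+* MvPolynomial (DPIdx P Q R S) ℂ)
      (fun w : (Q × S) ⊕ (P × S) => (X ((Sum.map Sum.inr Sum.inl : (Q × S) ⊕ (P × S) → DPIdx P Q R S) w) : MvPolynomial (DPIdx P Q R S) ℂ))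
      (aeval (Sum.elim
          (Sum.elim (fun pr : P × R => C (X (Sum.inl pr) : MvPolynomial ((P × R) ⊕ (Q × R)) ℂ)) (fun qs : Q × S => X (Sum.inl qs)))
          (Sum.elim (fun ps : P × S => X (Sum.inr ps)) (fun qr : Q × R => C (X (Sum.inr qr) : MvPolynomial ((P × R) ⊕ (Q × R)) ℂ))) :
          DPIdx P Q R S → MvPolynomial ((Q × S) ⊕ (P × S)) (MvPolynomial ((P × R) ⊕ (Q × R)) ℂ)) F) = F := by
  have key : (eval₂Hom ((rename (Sum.map Sum.inl Sum.inr : (P × R) ⊕ (Q × R) → DPIdx P Q R S) :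
        MvPolynomial ((P × R) ⊕ (Q × R)) ℂ →ₐ[ℂ] MvPolynomial (DPIdx P Q R S) ℂ) : MvPolynomial ((P × R) ⊕ (Q × R)) ℂ →+* MvPolynomial (DPIdx P Q R S) ℂ)
      (fun w : (Q × S) ⊕ (P × S) => (X ((Sum.map Sum.inr Sum.inl : (Q × S) ⊕ (P × S) → DPIdx P Q R S) w) : MvPolynomial (DPIdx P Q R S) ℂ))).comp
      ((aeval (Sum.elim
          (Sum.elim (fun pr : P × R => C (X (Sum.inl pr) : MvPolynomial ((P × R) ⊕ (Q × R)) ℂ)) (fun qs : Q × S => X (Sum.inl qs)))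
          (Sum.elim (fun ps : P × S => X (Sum.inr ps)) (fun qr : Q × R => C (X (Sum.inr qr) : MvPolynomial ((P × R) ⊕ (Q × R)) ℂ))) :
          DPIdx P Q R S → MvPolynomial ((Q × S) ⊕ (P × S)) (MvPolynomial ((P × R) ⊕ (Q × R)) ℂ)) : MvPolynomial (DPIdx P Q R S) ℂ →ₐ[ℂ] _) : MvPolynomial (DPIdx P Q R S) ℂ →+* _) =
      RingHom.id _ := by
    refine MvPolynomial.ringHom_ext (fun a => ?_) (fun z => ?_)
    · simp only [RingHom.comp_apply, RingHom.id_apply, RingHom.coe_coe, algHom_C, MvPolynomial.algebraMap_apply, algebraMap_eq, eval₂Hom_C]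
    · rcases z with (pr | qs) | (ps | qr)
      · simp only [RingHom.comp_apply, RingHom.id_apply, RingHom.coe_coe, aeval_X, Sum.elim_inl, eval₂Hom_C, rename_X, Sum.map_inl]
      · simp only [RingHom.comp_apply, RingHom.id_apply, RingHom.coe_coe, aeval_X, Sum.elim_inl, Sum.elim_inr, eval₂Hom_X', Sum.map_inl]
      · simp only [RingHom.comp_apply, RingHom.id_apply, RingHom.coe_coe, aeval_X, Sum.elim_inr, Sum.elim_inl, eval₂Hom_X', Sum.map_inr]
      · simp only [RingHom.comp_apply, RingHom.id_apply, RingHom.coe_coe, aeval_X, Sum.elim_inr, eval₂Hom_C, rename_X, Sum.map_inr]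
  have := congrArg (fun φ : MvPolynomial (DPIdx P Q R S) ℂ →+* MvPolynomial (DPIdx P Q R S) ℂ => φ F) key
  simpa only [RingHom.comp_apply, RingHom.id_apply, RingHom.coe_coe] using this

omit [Fintype P] [DecidableEq P] [Fintype Q] [DecidableEq Q] [Fintype R] [DecidableEq R] [Fintype S] [DecidableEq S] in
/-- **THE EXPANSION `F = Σ_ν ιR (coeff ν (Θ F)) · ιS (X^ν)`** of a Fock polynomial along the `S`-monomials with `R`-block coefficients. [folklore] -/
theorem eq_sum_rename_coeff_theta (F : MvPolynomial (DPIdx P Q R S) ℂ) :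
    F = ∑ ν ∈ (aeval (Sum.elim
          (Sum.elim (fun pr : P × R => C (X (Sum.inl pr) : MvPolynomial ((P × R) ⊕ (Q × R)) ℂ)) (fun qs : Q × S => X (Sum.inl qs)))
          (Sum.elim (fun ps : P × S => X (Sum.inr ps)) (fun qr : Q × R => C (X (Sum.inr qr) : MvPolynomial ((P × R) ⊕ (Q × R)) ℂ))) :
          DPIdx P Q R S → MvPolynomial ((Q × S) ⊕ (P × S)) (MvPolynomial ((P × R) ⊕ (Q × R)) ℂ)) F).support,
      rename (Sum.map Sum.inl Sum.inr : (P × R) ⊕ (Q × R) → DPIdx P Q R S)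
          (coeff ν (aeval (Sum.elim
          (Sum.elim (fun pr : P × R => C (X (Sum.inl pr) : MvPolynomial ((P × R) ⊕ (Q × R)) ℂ)) (fun qs : Q × S => X (Sum.inl qs)))
          (Sum.elim (fun ps : P × S => X (Sum.inr ps)) (fun qr : Q × R => C (X (Sum.inr qr) : MvPolynomial ((P × R) ⊕ (Q × R)) ℂ))) :
          DPIdx P Q R S → MvPolynomial ((Q × S) ⊕ (P × S)) (MvPolynomial ((P × R) ⊕ (Q × R)) ℂ)) F)) *
        rename (Sum.map Sum.inr Sum.inl : (Q × S) ⊕ (P × S) → DPIdx P Q R S) (monomial ν (1 : ℂ)) := by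
  set G := aeval (Sum.elim
          (Sum.elim (fun pr : P × R => C (X (Sum.inl pr) : MvPolynomial ((P × R) ⊕ (Q × R)) ℂ)) (fun qs : Q × S => X (Sum.inl qs)))
          (Sum.elim (fun ps : P × S => X (Sum.inr ps)) (fun qr : Q × R => C (X (Sum.inr qr) : MvPolynomial ((P × R) ⊕ (Q × R)) ℂ))) :
          DPIdx P Q R S → MvPolynomial ((Q × S) ⊕ (P × S)) (MvPolynomial ((P × R) ⊕ (Q × R)) ℂ)) F with hG
  have hι : ∀ ν : (Q × S) ⊕ (P × S) →₀ ℕ, rename (Sum.map Sum.inr Sum.inl : (Q × S) ⊕ (P × S) → DPIdx P Q R S) (monomial ν (1 : ℂ)) =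
      eval₂Hom ((rename (Sum.map Sum.inl Sum.inr : (P × R) ⊕ (Q × R) → DPIdx P Q R S) :
        MvPolynomial ((P × R) ⊕ (Q × R)) ℂ →ₐ[ℂ] MvPolynomial (DPIdx P Q R S) ℂ) : MvPolynomial ((P × R) ⊕ (Q × R)) ℂ →+* MvPolynomial (DPIdx P Q R S) ℂ)
      (fun w : (Q × S) ⊕ (P × S) => (X ((Sum.map Sum.inr Sum.inl : (Q × S) ⊕ (P × S) → DPIdx P Q R S) w) : MvPolynomial (DPIdx P Q R S) ℂ))
        (monomial ν (1 : MvPolynomial ((P × R) ⊕ (Q × R)) ℂ)) := by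
    intro ν
    have h1 := eval₂Hom_theta (P := P) (Q := Q) (R := R) (S := S) (rename (Sum.map Sum.inr Sum.inl : (Q × S) ⊕ (P × S) → DPIdx P Q R S) (monomial ν (1 : ℂ)))
    rw [theta_rename_S, map_monomial, map_one] at h1
    exact h1.symm
  conv_lhs => rw [← eval₂Hom_theta (P := P) (Q := Q) (R := R) (S := S) F, ← hG, G.as_sum, map_sum]
  refine Finset.sum_congr rfl fun ν _ => ?_
  rw [hι, eval₂Hom_monomial, eval₂Hom_monomial, map_one, one_mul, RingHom.coe_coe]


omit [Fintype P] [DecidableEq P] [Fintype Q] [DecidableEq Q] [Fintype R] [DecidableEq R] [Fintype S] [DecidableEq S] in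
/-- **COEFFICIENT EXTRACTION**: `coeff ν (Θ (Σ_l ιR (β l) · ιS (g l))) = Σ_l coeff ν (g l) • β l` — the `A_R`-coefficient of an `S`-monomial in a sum of
block products. [folklore] -/
theorem coeff_theta_sum {κ : Type*} (s : Finset κ) (β : κ → MvPolynomial ((P × R) ⊕ (Q × R)) ℂ)
    (g : κ → MvPolynomial ((Q × S) ⊕ (P × S)) ℂ) (ν : (Q × S) ⊕ (P × S) →₀ ℕ) :
    coeff ν (aeval (Sum.elim
          (Sum.elim (fun pr : P × R => C (X (Sum.inl pr) : MvPolynomial ((P × R) ⊕ (Q × R)) ℂ)) (fun qs : Q × S => X (Sum.inl qs)))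
          (Sum.elim (fun ps : P × S => X (Sum.inr ps)) (fun qr : Q × R => C (X (Sum.inr qr) : MvPolynomial ((P × R) ⊕ (Q × R)) ℂ))) :
          DPIdx P Q R S → MvPolynomial ((Q × S) ⊕ (P × S)) (MvPolynomial ((P × R) ⊕ (Q × R)) ℂ))
        (∑ l ∈ s, rename (Sum.map Sum.inl Sum.inr : (P × R) ⊕ (Q × R) → DPIdx P Q R S) (β l) *
          rename (Sum.map Sum.inr Sum.inl : (Q × S) ⊕ (P × S) → DPIdx P Q R S) (g l))) =
      ∑ l ∈ s, coeff ν (g l) • β l := by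
  rw [map_sum, coeff_sum]
  refine Finset.sum_congr rfl fun l _ => ?_
  rw [map_mul, theta_rename_R, theta_rename_S, coeff_C_mul, coeff_map, smul_eq_C_mul, mul_comm, MvPolynomial.algebraMap_eq]

omit [Fintype P] [DecidableEq P] [Fintype Q] [DecidableEq Q] in
/-- **`σ_1 = id`**: the block substitution at the identity of `U(R)` is the identity. [folklore] -/
theorem aeval_sigma_one (f : MvPolynomial ((P × R) ⊕ (Q × R)) ℂ) :
    aeval (Sum.elim (fun pr : P × R => ∑ b : R, X (Sum.inl (pr.1, b)) * C (((1 : Matrix.unitaryGroup R ℂ) : Matrix R R ℂ) b pr.2))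
          (fun qr : Q × R => ∑ b : R, X (Sum.inr (qr.1, b)) * C ((star ((1 : Matrix.unitaryGroup R ℂ) : Matrix R R ℂ)) qr.2 b)) :
            (P × R) ⊕ (Q × R) → MvPolynomial ((P × R) ⊕ (Q × R)) ℂ) f = f := by
  have key : (Sum.elim (fun pr : P × R => ∑ b : R, X (Sum.inl (pr.1, b)) * C (((1 : Matrix.unitaryGroup R ℂ) : Matrix R R ℂ) b pr.2))
          (fun qr : Q × R => ∑ b : R, X (Sum.inr (qr.1, b)) * C ((star ((1 : Matrix.unitaryGroup R ℂ) : Matrix R R ℂ)) qr.2 b)) :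
            (P × R) ⊕ (Q × R) → MvPolynomial ((P × R) ⊕ (Q × R)) ℂ) = X := by
    funext v
    rcases v with ⟨p, r⟩ | ⟨q, r⟩
    · simp only [Sum.elim_inl, OneMemClass.coe_one, Matrix.one_apply, apply_ite C, map_one, map_zero, mul_ite, mul_one, mul_zero,
        Finset.sum_ite_eq', Finset.mem_univ, if_true]
    · simp only [Sum.elim_inr, OneMemClass.coe_one, star_one, Matrix.one_apply, apply_ite C, map_one, map_zero, mul_ite, mul_one,
        mul_zero, Finset.sum_ite_eq, Finset.mem_univ, if_true]
  rw [key, aeval_X_left_apply]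

end Summit.HodgeConjecture.HodgeConjecture.Cruxes.HLiu418.K2LiuFockPolySubstBridge
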